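import Literature.NumberTheory.GelbartRogawski1991.DoubledUnitaryGlobalSplittingData
import Literature.NumberTheory.Weil1964.AdelicMetaplecticRationalLiftRelabel
import Literature.NumberTheory.GelbartRogawski1991.DoubledUnitaryConj
import Literature.NumberTheory.GaloisRepresentations.CMTypeHeckeCharacter
import Literature.NumberTheory.Automorphic.ClassFieldCharacter
import Literature.NumberTheory.Automorphic.IdeleClassCharacterAlgebraicTwist
import HarnessLib

/-!
# The doubled Weil representation with character `χ` transports, along a conjugation `θ` of the doubled unitary group lying
# over the relabelling `Λ = (x, y) ↦ (x, −y)`, to the doubled Weil representation with character `χ ∘ c`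

Topic `NumberTheory/GelbartRogawski1991`; namespace `Literature.NumberTheory.GelbartRogawski1991.GRConstruction`.  THEOREMS ONLY (no
definition, no named fact, no `sorry`).  RSCONJ row Ω, ROUTE C (`HOME/d2bridge/ident/ident-1/omega/OMEGA-ROUTE-C.md` §3 (C3′)(i)): the LABEL of
the θ-twisted splitting.  [GelbartRogawski1991, §3.1 Prop. 3.1.1 p. 455 L1–2]: the doubled Weil representation `sD` of `H = U(𝕍 ⊕ −𝕍)` with
character `χ` is PINNED by its normalisation on the Siegel parabolic `P_Δ(𝔸)`, «`χ(det_Δ p) |det_Δ p|^{1/2}`» (the tree's interface Prop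
`IsDoubledWeilRep χ sD`, ✔ `DoubledUnitaryGlobalSplittingData`; unique by ✔ `isDoubledWeilRep_unique`).  For two W-frames `dW` (source) and `dW′`
(target) of the partner line with `T^𝔻(dW′) · (−1) = T^𝔻(dW)` (`hC`; e.g. the lines `⟨−a⟩` and `⟨a⟩`) and a homomorphism `θ : H′(𝔸) →* H(𝔸)`
that is ENTRYWISE the conjugation `c ⊗ 1` of `𝔸_L` (`hθ`) and lies over `Λ` on the doubled symplectic space (`hθsp`: `Λ ι^𝔻(θ h) Λ⁻¹ = ι′^𝔻(h)`),
continuous (`hθc`):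

* §1 bookkeeping under `hθ`: `θ` preserves the Siegel parabolic (`isSiegelDelta_conj_iff`), conjugates `det_Δ` (`detDelta_conj`), so
  `χ(det_Δ (θ p)) = (χ ∘ c)(det_Δ p)` (`chiDet_conj`, ✔ `HeckeCharacter.galConj`) and `|det_Δ (θ p)| = |det_Δ p|` (`modDelta_conj`, ✔ `ideleNorm_galSMul`);
* §2 `R (r_F^𝔻(δ)) = r_F^{𝔻′}(δ)` along the relabelling `R = adelicMpContRelabel (−1) hC : Mp(𝕎^𝔻)ᶜᵒⁿᵗ ≃* Mp(𝕎^{𝔻′})ᶜᵒⁿᵗ` — Weil's rational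
  element `δ = deltaD` does not move (Θ-rigidity, ✔ `adelicMpRelabel_eq_of_proj_eq`; the rational matrix is the same, `coe_transportSp_apply_blocks`);
* §3 **`isDoubledWeilRep_relabel_comp_conj`**: `IsDoubledWeilRep χ sD → IsDoubledWeilRep (galConj c χ) (R ∘ sD ∘ θ)` — continuity,
  `π′ ∘ sD′ = ι′^𝔻` (`π ∘ R = (Λ·Λ⁻¹) ∘ π` + `hθsp`), and the parabolic normalisation (the operator of `R m` IS that of `m`, ✔ `adelicMpCont.omega_relabel`).
* §4 **`isDoubledWeilRep_relabel_comp_conjH`**: the instance of record at `θ := conjH hneg` (✔-desk `DoubledUnitaryConj`: the concrete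
  entrywise conjugation `h ↦ h̄` between the doubled groups at `dW′` and `dW = −dW′`; `coe_coe_conjH`, `continuous_conjH`, `symplecticGroupCongr_toSpD_conjH`).

In §1–§3 `θ` and its two properties are HYPOTHESES; §4 supplies the concrete entrywise conjugation `conjH` (the doubled twin of ident-1's `pairConj`
∕ wb-10's ✔ `UnitaryGroup.finAdelicConj`).  Nothing of [GelbartRogawski1991] is asserted.  Cell pub-hodgecm2 (COR-CM).

## References
* [GelbartRogawski1991] S. Gelbart, J. Rogawski, Invent. Math. 105 (1991), §3.1 Prop. 3.1.1 p. 455 L1–2, Remark p. 457 L4–13.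
* [Kudla1994] S. Kudla, Israel J. Math. 87 (1994), §2 (doubled space, Siegel parabolic), §3 Thm. 3.1.
* [HarrisKudlaSweet1996] M. Harris, S. Kudla, W. J. Sweet, J. AMS 9 (1996), §1 (1.14)–(1.15) (`ω(m(a))φ = χ(det a)|det a|^{1/2} φ(·a)`).
* [Weil1964] A. Weil, Acta Math. 111 (1964), Chap. III n° 40–41 (the rational section, `Θ`-fixing), n° 46 p. 202.
-/

set_option autoImplicit false

noncomputable section

open scoped Classical
open scoped Matrix
open NumberField IsDedekindDomain
open Literature.RepresentationTheory.HeisenbergGroup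
open Literature.NumberTheory.Automorphic
open Literature.NumberTheory.Weil1964
open Literature.NumberTheory.GaloisRepresentations

namespace Literature.NumberTheory.GelbartRogawski1991.GRConstruction

open UnitaryDualPair
open Literature.NumberTheory.Automorphic.UnitaryGroup (symplecticGroupCongr symplecticGroupCongr_injective coe_symplecticGroupCongr_apply
  conjAdele conjAdele_apply)
open Literature.NumberTheory.GaloisRepresentations.HeckeCharacter (galConj galConj_apply complexConj_mul_self)

variable (L : Type) [Field L] [NumberField L] [IsCMField L]
variable {N M n : ℕ} (e : Fin N × Fin M ≃ Fin n)
  (dV : Fin N → L) (hdV : ∀ i, IsCMField.complexConj L (dV i) = dV i) (hdV0 : ∀ i, dV i ≠ 0)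
  (dW : Fin M → L) (hdW : ∀ i, IsCMField.complexConj L (dW i) = dW i) (hdW0 : ∀ i, dW i ≠ 0)
  (dW' : Fin M → L) (hdW' : ∀ i, IsCMField.complexConj L (dW' i) = dW' i) (hdW0' : ∀ i, dW' i ≠ 0)

/-! ## §0 The conjugation `c ⊗ 1` of `𝔸_L` is an involution -/

section Conj

variable {L}

/-- `c • (c • x) = x` on `𝔸_L` (`c² = 1`). [folklore] -/
private theorem conjAdele_conjAdele_cm (x : AdeleRing (𝓞 L) L) :
    conjAdele (Fp L) L (IsCMField.complexConj L) (conjAdele (Fp L) L (IsCMField.complexConj L) x) = x := by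
  rw [conjAdele_apply, conjAdele_apply, smul_smul, complexConj_mul_self, one_smul]

/-- `c ⊗ 1` is injective on `𝔸_L`. [folklore] -/
private theorem conjAdele_cm_injective : Function.Injective (conjAdele (Fp L) L (IsCMField.complexConj L)) :=
  fun x y h => by rw [← conjAdele_conjAdele_cm x, h, conjAdele_conjAdele_cm]

/-- `(M.map c̃).map c̃ = M` for matrices over `𝔸_L`. [folklore] -/
private theorem map_conjAdele_map_conjAdele_cm {ι κ : Type*} (A : Matrix ι κ (AdeleRing (𝓞 L) L)) :
    (A.map (conjAdele (Fp L) L (IsCMField.complexConj L))).map (conjAdele (Fp L) L (IsCMField.complexConj L)) = A := by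
  ext i j; exact conjAdele_conjAdele_cm (A i j)

/-- `IsUnit (c • x) ↔ IsUnit x` on `𝔸_L`. [folklore] -/
private theorem isUnit_conjAdele_cm_iff (x : AdeleRing (𝓞 L) L) :
    IsUnit (conjAdele (Fp L) L (IsCMField.complexConj L) x) ↔ IsUnit x := by
  refine ⟨fun h => ?_, fun h => h.map _⟩
  have h' := h.map (conjAdele (Fp L) L (IsCMField.complexConj L))
  rwa [conjAdele_conjAdele_cm] at h'

/-- the unit underlying `c • x` is `c • (the unit underlying x)`. [folklore] -/
private theorem unit_conjAdele_cm {x : AdeleRing (𝓞 L) L} (hx : IsUnit x) (hcx : IsUnit (conjAdele (Fp L) L (IsCMField.complexConj L) x)) :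
    hcx.unit = IsCMField.complexConj L • hx.unit :=
  Units.ext (by rw [IsUnit.unit_spec, AdeleRing.coe_smul_units, IsUnit.unit_spec, conjAdele_apply])

end Conj

/-! ## §1 The Siegel parabolic, `det_Δ`, `χ(det_Δ ·)` and `|det_Δ ·|` under an entrywise conjugation `θ` -/

section Siegel

variable {L e dV hdV dW hdW dW' hdW'}
variable {θ : HA L e dV hdV dW' hdW' →* HA L e dV hdV dW hdW}

/-- the block matrix of `θ h` is the entrywise conjugate of that of `h`. [cite: Kudla1994, §2 (doubled space, Siegel parabolic)] -/
theorem blk_conj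
    (hθ : ∀ h : HA L e dV hdV dW' hdW',
      (((θ h : HA L e dV hdV dW hdW) : GL (Fin (n + n)) (AdeleRing (𝓞 L) L)) : Matrix (Fin (n + n)) (Fin (n + n)) (AdeleRing (𝓞 L) L)) =
        (((h : HA L e dV hdV dW' hdW') : GL (Fin (n + n)) (AdeleRing (𝓞 L) L)) :
          Matrix (Fin (n + n)) (Fin (n + n)) (AdeleRing (𝓞 L) L)).map (conjAdele (Fp L) L (IsCMField.complexConj L))) (h : HA L e dV hdV dW' hdW') :
    blk L e dV hdV dW hdW (θ h) = (blk L e dV hdV dW' hdW' h).map (conjAdele (Fp L) L (IsCMField.complexConj L)) := by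
  rw [blk, blk, hθ, Matrix.reindex_apply, Matrix.reindex_apply, Matrix.submatrix_map]

/-- the `Δ`-block of `θ h` is the conjugate of that of `h`. [cite: Kudla1994, §2 (doubled space, Siegel parabolic)] -/
theorem deltaBlock_conj
    (hθ : ∀ h : HA L e dV hdV dW' hdW',
      (((θ h : HA L e dV hdV dW hdW) : GL (Fin (n + n)) (AdeleRing (𝓞 L) L)) : Matrix (Fin (n + n)) (Fin (n + n)) (AdeleRing (𝓞 L) L)) =
        (((h : HA L e dV hdV dW' hdW') : GL (Fin (n + n)) (AdeleRing (𝓞 L) L)) :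
          Matrix (Fin (n + n)) (Fin (n + n)) (AdeleRing (𝓞 L) L)).map (conjAdele (Fp L) L (IsCMField.complexConj L))) (h : HA L e dV hdV dW' hdW') :
    deltaBlock L e dV hdV dW hdW (θ h) = (deltaBlock L e dV hdV dW' hdW' h).map (conjAdele (Fp L) L (IsCMField.complexConj L)) := by
  rw [deltaBlock, deltaBlock, blk_conj hθ, Matrix.map_add _ (map_add _)]
  rfl

/-- **`det_Δ (θ h) = c • det_Δ h`** (determinant commutes with the ring homomorphism `c ⊗ 1`).
[cite: Kudla1994, §2 (doubled space, Siegel parabolic)] -/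
theorem detDelta_conj
    (hθ : ∀ h : HA L e dV hdV dW' hdW',
      (((θ h : HA L e dV hdV dW hdW) : GL (Fin (n + n)) (AdeleRing (𝓞 L) L)) : Matrix (Fin (n + n)) (Fin (n + n)) (AdeleRing (𝓞 L) L)) =
        (((h : HA L e dV hdV dW' hdW') : GL (Fin (n + n)) (AdeleRing (𝓞 L) L)) :
          Matrix (Fin (n + n)) (Fin (n + n)) (AdeleRing (𝓞 L) L)).map (conjAdele (Fp L) L (IsCMField.complexConj L))) (h : HA L e dV hdV dW' hdW') :
    detDelta L e dV hdV dW hdW (θ h) = conjAdele (Fp L) L (IsCMField.complexConj L) (detDelta L e dV hdV dW' hdW' h) := by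
  rw [detDelta, detDelta, deltaBlock_conj hθ, RingHom.map_det, RingHom.mapMatrix_apply]

/-- **`θ` preserves the Siegel parabolic `P_Δ`** (`h₁₁ + h₁₂ = h₂₁ + h₂₂` is an identity of matrices, preserved and reflected by the
injective entrywise conjugation). [cite: Kudla1994, §2 (doubled space, Siegel parabolic)] -/
theorem isSiegelDelta_conj_iff
    (hθ : ∀ h : HA L e dV hdV dW' hdW',
      (((θ h : HA L e dV hdV dW hdW) : GL (Fin (n + n)) (AdeleRing (𝓞 L) L)) : Matrix (Fin (n + n)) (Fin (n + n)) (AdeleRing (𝓞 L) L)) =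
        (((h : HA L e dV hdV dW' hdW') : GL (Fin (n + n)) (AdeleRing (𝓞 L) L)) :
          Matrix (Fin (n + n)) (Fin (n + n)) (AdeleRing (𝓞 L) L)).map (conjAdele (Fp L) L (IsCMField.complexConj L))) (h : HA L e dV hdV dW' hdW') :
    IsSiegelDelta L e dV hdV dW hdW (θ h) ↔ IsSiegelDelta L e dV hdV dW' hdW' h := by
  unfold IsSiegelDelta
  rw [blk_conj hθ]
  change ((blk L e dV hdV dW' hdW' h).toBlocks₁₁.map ⇑(conjAdele (Fp L) L (IsCMField.complexConj L)) +
        (blk L e dV hdV dW' hdW' h).toBlocks₁₂.map ⇑(conjAdele (Fp L) L (IsCMField.complexConj L)) =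
      (blk L e dV hdV dW' hdW' h).toBlocks₂₁.map ⇑(conjAdele (Fp L) L (IsCMField.complexConj L)) +
        (blk L e dV hdV dW' hdW' h).toBlocks₂₂.map ⇑(conjAdele (Fp L) L (IsCMField.complexConj L))) ↔ _
  rw [← Matrix.map_add _ (map_add _), ← Matrix.map_add _ (map_add _)]
  exact (Matrix.map_injective conjAdele_cm_injective).eq_iff

/-- `det_Δ (θ h)` is a unit iff `det_Δ h` is. [cite: Kudla1994, §2 (doubled space, Siegel parabolic)] -/
theorem isUnit_detDelta_conj_iff
    (hθ : ∀ h : HA L e dV hdV dW' hdW',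
      (((θ h : HA L e dV hdV dW hdW) : GL (Fin (n + n)) (AdeleRing (𝓞 L) L)) : Matrix (Fin (n + n)) (Fin (n + n)) (AdeleRing (𝓞 L) L)) =
        (((h : HA L e dV hdV dW' hdW') : GL (Fin (n + n)) (AdeleRing (𝓞 L) L)) :
          Matrix (Fin (n + n)) (Fin (n + n)) (AdeleRing (𝓞 L) L)).map (conjAdele (Fp L) L (IsCMField.complexConj L))) (h : HA L e dV hdV dW' hdW') :
    IsUnit (detDelta L e dV hdV dW hdW (θ h)) ↔ IsUnit (detDelta L e dV hdV dW' hdW' h) := by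
  rw [detDelta_conj hθ, isUnit_conjAdele_cm_iff]

/-- **`χ(det_Δ (θ p)) = (χ ∘ c)(det_Δ p)`** — the character scalar of the parabolic normalisation is conjugated into
`HeckeCharacter.galConj c χ`. [cite: GelbartRogawski1991, §3.1 Prop. 3.1.1 p. 455 L1–2] [cite: HarrisKudlaSweet1996, §1 (1.14)–(1.15)] -/
theorem chiDet_conj
    (hθ : ∀ h : HA L e dV hdV dW' hdW',
      (((θ h : HA L e dV hdV dW hdW) : GL (Fin (n + n)) (AdeleRing (𝓞 L) L)) : Matrix (Fin (n + n)) (Fin (n + n)) (AdeleRing (𝓞 L) L)) =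
        (((h : HA L e dV hdV dW' hdW') : GL (Fin (n + n)) (AdeleRing (𝓞 L) L)) :
          Matrix (Fin (n + n)) (Fin (n + n)) (AdeleRing (𝓞 L) L)).map (conjAdele (Fp L) L (IsCMField.complexConj L))) (χ : HeckeCharacter L) (p : HA L e dV hdV dW' hdW') :
    chiDet L e dV hdV dW hdW χ (θ p) = chiDet L e dV hdV dW' hdW' (galConj (IsCMField.complexConj L) χ) p := by
  unfold chiDet
  by_cases hu : IsUnit (detDelta L e dV hdV dW' hdW' p)
  · have hu' : IsUnit (detDelta L e dV hdV dW hdW (θ p)) := (isUnit_detDelta_conj_iff hθ p).2 hu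
    rw [dif_pos hu', dif_pos hu, galConj_apply]
    congr 1
    have hcu : IsUnit (conjAdele (Fp L) L (IsCMField.complexConj L) (detDelta L e dV hdV dW' hdW' p)) := by
      rwa [← detDelta_conj hθ]
    have e1 : hu'.unit = hcu.unit := Units.ext (by rw [IsUnit.unit_spec, IsUnit.unit_spec, detDelta_conj hθ])
    rw [e1, unit_conjAdele_cm hu hcu]
  · have hu' : ¬ IsUnit (detDelta L e dV hdV dW hdW (θ p)) := fun h' => hu ((isUnit_detDelta_conj_iff hθ p).1 h')
    rw [dif_neg hu', dif_neg hu]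

/-- **`|det_Δ (θ p)|^{1/2} = |det_Δ p|^{1/2}`** (the idelic norm is Galois-invariant, ✔ `ideleNorm_galSMul`).
[cite: GelbartRogawski1991, §3.1 Prop. 3.1.1 p. 455 L1–2] -/
theorem modDelta_conj
    (hθ : ∀ h : HA L e dV hdV dW' hdW',
      (((θ h : HA L e dV hdV dW hdW) : GL (Fin (n + n)) (AdeleRing (𝓞 L) L)) : Matrix (Fin (n + n)) (Fin (n + n)) (AdeleRing (𝓞 L) L)) =
        (((h : HA L e dV hdV dW' hdW') : GL (Fin (n + n)) (AdeleRing (𝓞 L) L)) :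
          Matrix (Fin (n + n)) (Fin (n + n)) (AdeleRing (𝓞 L) L)).map (conjAdele (Fp L) L (IsCMField.complexConj L))) (p : HA L e dV hdV dW' hdW') :
    modDelta L e dV hdV dW hdW (θ p) = modDelta L e dV hdV dW' hdW' p := by
  unfold modDelta
  by_cases hu : IsUnit (detDelta L e dV hdV dW' hdW' p)
  · have hu' : IsUnit (detDelta L e dV hdV dW hdW (θ p)) := (isUnit_detDelta_conj_iff hθ p).2 hu
    rw [dif_pos hu', dif_pos hu]
    have hcu : IsUnit (conjAdele (Fp L) L (IsCMField.complexConj L) (detDelta L e dV hdV dW' hdW' p)) := by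
      rwa [← detDelta_conj hθ]
    have e1 : hu'.unit = hcu.unit := Units.ext (by rw [IsUnit.unit_spec, IsUnit.unit_spec, detDelta_conj hθ])
    rw [e1, unit_conjAdele_cm hu hcu, ideleNorm_galSMul]
  · have hu' : ¬ IsUnit (detDelta L e dV hdV dW hdW (θ p)) := fun h' => hu ((isUnit_detDelta_conj_iff hθ p).1 h')
    rw [dif_neg hu', dif_neg hu]

end Siegel

/-! ## §2 Weil's rational element `r_F^𝔻(δ)` under the relabelling: `R (r_F^𝔻(δ)) = r_F^{𝔻′}(δ)` -/

section Delta

variable {L e dV hdV dW hdW dW' hdW'}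

/-- **`R (r_F^𝔻(δ)) = r_F^{𝔻′}(δ)`**: along `R = adelicMpContRelabel (−1) hC : Mp(𝕎^𝔻)ᶜᵒⁿᵗ ≃* Mp(𝕎^{𝔻′})ᶜᵒⁿᵗ` Weil's Θ-rigid lift of the
RATIONAL element `δ = deltaD` (the same matrix for both data) does not move (✔-desk `adelicMpContRelabel_negOne_ratThetaLiftCont`).
[cite: Weil1964, Chap. III n° 40 p. 190, n° 41 Thm 6 p. 193] [cite: GelbartRogawski1991, §3.1 Prop. 3.1.1 p. 455 L1–2] -/
theorem relabel_rDelta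
    (hC : gramDA L e dV hdV dW' hdW' *
      (((-1 : GL (Fin (n + n)) (AdeleRing (𝓞 (Fp L)) (Fp L))) : GL (Fin (n + n)) (AdeleRing (𝓞 (Fp L)) (Fp L))) :
        Matrix (Fin (n + n)) (Fin (n + n)) (AdeleRing (𝓞 (Fp L)) (Fp L))) = gramDA L e dV hdV dW hdW) :
    adelicMpContRelabel (Fp L) (Fin (n + n)) (-1) hC (rDelta L e dV hdV hdV0 dW hdW hdW0) = rDelta L e dV hdV hdV0 dW' hdW' hdW0' :=
  adelicMpContRelabel_negOne_ratThetaLiftCont (Fp L) (gramDA L e dV hdV dW' hdW') (isUnit_det_gramDA L e dV hdV hdV0 dW' hdW' hdW0')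
    hC (isUnit_det_gramDA L e dV hdV hdV0 dW hdW hdW0) (deltaD L)

end Delta

/-! ## §3 THE TRANSPORT: `IsDoubledWeilRep χ sD → IsDoubledWeilRep (χ ∘ c) (R ∘ sD ∘ θ)` -/

/-- group bookkeeping: `r′ · R x · r′⁻¹ = R (r · x · r⁻¹)` when `R r = r′` (stated abstractly so that no large type is unfolded). [folklore] -/
private theorem conj_eq_map_conj {G H : Type*} [Group G] [Group H] (R : G ≃* H) (r : G) {r' : H} (hr : R r = r') (x : G) :
    r' * R x * r'⁻¹ = R (r * x * r⁻¹) := by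
  subst hr
  rw [map_mul, map_mul, map_inv]

section Transport

variable {L e dV hdV dW hdW dW' hdW'}

set_option maxHeartbeats 1600000 in
-- (the `IsDoubledWeilRep` telescopes of BOTH data are compared in `isDefEq`; budget of ✔ `DoubledUnitaryGlobalSplittingData` §4)
/-- **THE DOUBLED WEIL REPRESENTATION WITH CHARACTER `χ` TRANSPORTS TO THE ONE WITH CHARACTER `χ ∘ c`.**  For `sD : H(𝔸) →* Mp(𝕎^𝔻)ᶜᵒⁿᵗ`
`χ`-normalised (`IsDoubledWeilRep χ sD`), a continuous homomorphism `θ : H′(𝔸) →* H(𝔸)` that is entrywise `c ⊗ 1` (`hθ`) and lies over the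
relabelling `Λ` (`hθsp`), and the relabelling `R : Mp(𝕎^𝔻)ᶜᵒⁿᵗ ≃* Mp(𝕎^{𝔻′})ᶜᵒⁿᵗ` (`hC`): `sD′ := R ∘ sD ∘ θ : H′(𝔸) →* Mp(𝕎^{𝔻′})ᶜᵒⁿᵗ` is
`(χ ∘ c)`-normalised — continuous; `π′ ∘ sD′ = ι′^𝔻` (`π′ ∘ R = (Λ·Λ⁻¹) ∘ π`); and on `p ∈ P_Δ′(𝔸)`: `θ p ∈ P_Δ(𝔸)`, the operator of
`r′(δ) sD′(p) r′(δ)⁻¹ = R (r(δ) sD(θ p) r(δ)⁻¹)` IS that of `r(δ) sD(θ p) r(δ)⁻¹` (`R r(δ) = r′(δ)`, ✔ `adelicMpCont.omega_relabel`), whose value at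
the origin is `χ(det_Δ (θ p)) |det_Δ (θ p)|^{1/2} Φ(0) = (χ ∘ c)(det_Δ p) |det_Δ p|^{1/2} Φ(0)` (`chiDet_conj`, `modDelta_conj`).
[cite: GelbartRogawski1991, §3.1 Prop. 3.1.1 p. 455 L1–2, Remark p. 457 L4–13] [cite: HarrisKudlaSweet1996, §1 (1.14)–(1.15)] [cite: Kudla1994, §3 Thm. 3.1] -/
theorem isDoubledWeilRep_relabel_comp_conj
    (hC : gramDA L e dV hdV dW' hdW' *
      (((-1 : GL (Fin (n + n)) (AdeleRing (𝓞 (Fp L)) (Fp L))) : GL (Fin (n + n)) (AdeleRing (𝓞 (Fp L)) (Fp L))) :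
        Matrix (Fin (n + n)) (Fin (n + n)) (AdeleRing (𝓞 (Fp L)) (Fp L))) = gramDA L e dV hdV dW hdW)
    {θ : HA L e dV hdV dW' hdW' →* HA L e dV hdV dW hdW}
    (hθ : ∀ h : HA L e dV hdV dW' hdW',
      (((θ h : HA L e dV hdV dW hdW) : GL (Fin (n + n)) (AdeleRing (𝓞 L) L)) : Matrix (Fin (n + n)) (Fin (n + n)) (AdeleRing (𝓞 L) L)) =
        (((h : HA L e dV hdV dW' hdW') : GL (Fin (n + n)) (AdeleRing (𝓞 L) L)) :
          Matrix (Fin (n + n)) (Fin (n + n)) (AdeleRing (𝓞 L) L)).map (conjAdele (Fp L) L (IsCMField.complexConj L)))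
    (hθc : Continuous θ)
    (hθsp : ∀ h : HA L e dV hdV dW' hdW',
      symplecticGroupCongr _ _ (relabelVec (Fp L) (Fin (n + n)) (-1)) (polar_relabelVec (Fp L) (Fin (n + n)) (-1) hC)
          (toSpD L e dV hdV dW hdW (θ h)) = toSpD L e dV hdV dW' hdW' h)
    (χ : HeckeCharacter L) {sD : HA L e dV hdV dW hdW →* MpD L e dV hdV dW hdW}
    (hsD : IsDoubledWeilRep L e dV hdV hdV0 dW hdW hdW0 χ sD) (hdW0' : ∀ i, dW' i ≠ 0) :
    IsDoubledWeilRep L e dV hdV hdV0 dW' hdW' hdW0' (galConj (IsCMField.complexConj L) χ)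
      (((adelicMpContRelabel (Fp L) (Fin (n + n)) (-1) hC).toMonoidHom.comp sD).comp θ) := by
  refine ⟨?_, fun h => ?_, fun p hp hu Φ => ?_⟩
  · -- continuity: `R`, `sD`, `θ` are continuous
    exact (continuous_adelicMpContRelabel (Fp L) (Fin (n + n)) (-1) hC).comp (hsD.continuous.comp hθc)
  · -- `π′ (R (sD (θ h))) = Λ π(sD (θ h)) Λ⁻¹ = Λ ι^𝔻(θ h) Λ⁻¹ = ι′^𝔻 h`
    rw [MonoidHom.comp_apply, MonoidHom.comp_apply]
    have e1 : projD L e dV hdV dW' hdW' ((adelicMpContRelabel (Fp L) (Fin (n + n)) (-1) hC).toMonoidHom (sD (θ h))) =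
        symplecticGroupCongr _ _ (relabelVec (Fp L) (Fin (n + n)) (-1)) (polar_relabelVec (Fp L) (Fin (n + n)) (-1) hC)
          (projD L e dV hdV dW hdW (sD (θ h))) :=
      adelicMpCont.proj_relabel (Fp L) (Fin (n + n)) (-1) hC (sD (θ h))
    rw [e1, hsD.proj_eq (θ h), hθsp h]
  · -- the parabolic normalisation at `p ∈ P_Δ′(𝔸)`
    have hp' : IsSiegelDelta L e dV hdV dW hdW (θ p) := (isSiegelDelta_conj_iff hθ p).2 hp
    have hu' : IsUnit (detDelta L e dV hdV dW hdW (θ p)) := (isUnit_detDelta_conj_iff hθ p).2 hu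
    have key := hsD.parabolic (θ p) hp' hu' Φ
    -- `r′(δ) sD′(p) r′(δ)⁻¹ = R (r(δ) sD(θ p) r(δ)⁻¹)`
    have e1 : rDelta L e dV hdV hdV0 dW' hdW' hdW0' *
            (((adelicMpContRelabel (Fp L) (Fin (n + n)) (-1) hC).toMonoidHom.comp sD).comp θ) p *
          (rDelta L e dV hdV hdV0 dW' hdW' hdW0')⁻¹ =
        adelicMpContRelabel (Fp L) (Fin (n + n)) (-1) hC
          (rDelta L e dV hdV hdV0 dW hdW hdW0 * sD (θ p) * (rDelta L e dV hdV hdV0 dW hdW hdW0)⁻¹) :=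
      conj_eq_map_conj (adelicMpContRelabel (Fp L) (Fin (n + n)) (-1) hC) (rDelta L e dV hdV hdV0 dW hdW hdW0)
        (relabel_rDelta hdV0 hdW0 hdW0' hC) (sD (θ p))
    -- the operator of `R m` is the operator of `m`
    have e2 : ∀ m : MpD L e dV hdV dW hdW,
        opD L e dV hdV dW' hdW' (adelicMpContRelabel (Fp L) (Fin (n + n)) (-1) hC m) Φ = opD L e dV hdV dW hdW m Φ := fun m =>
      congrArg (fun T : Module.End ℂ (piSchwartzBruhat (Fp L) (Fin (n + n))) =>
        ((T Φ : piSchwartzBruhat (Fp L) (Fin (n + n))) : (Fin (n + n) → AdeleRing (𝓞 (Fp L)) (Fp L)) → ℂ))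
        (adelicMpCont.omega_relabel (Fp L) (Fin (n + n)) (-1) hC m)
    rw [e1, e2, key, chiDet_conj hθ, modDelta_conj hθ]

end Transport

/-! ## §4 THE TRANSPORT AT THE CONJUGATION OF RECORD: `IsDoubledWeilRep χ sD → IsDoubledWeilRep (χ ∘ c) (R ∘ sD ∘ (h ↦ h̄))` -/

section TransportConjH

variable {L e dV hdV dW hdW dW' hdW'}

open Literature.NumberTheory.GaloisRepresentations.HeckeCharacter (galConj)

/-- **THE `χ`-NORMALISED DOUBLED WEIL REPRESENTATION AT `dW`, CONJUGATED, IS THE `(χ ∘ c)`-NORMALISED ONE AT `dW′ = −dW`**: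
`sD′ := R ∘ sD ∘ (h ↦ h̄)` with `R = adelicMpContRelabel (−1) (gramDA_mul_negOne hneg)` satisfies `IsDoubledWeilRep (galConj c χ) sD′`
(§3 `isDoubledWeilRep_relabel_comp_conj` at `θ := conjH hneg` of ✔-desk `DoubledUnitaryConj`: `coe_coe_conjH`, `continuous_conjH`, `symplecticGroupCongr_toSpD_conjH`).
[cite: GelbartRogawski1991, §3.1 Prop. 3.1.1 p. 455 L1–2, Remark p. 457 L4–13] [cite: Kudla1994, §3 Thm. 3.1] -/
theorem isDoubledWeilRep_relabel_comp_conjH (hdV0 : ∀ i, dV i ≠ 0) (hdW0 : ∀ i, dW i ≠ 0) (hdW0' : ∀ i, dW' i ≠ 0)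
    (hneg : realDiagonal L dW hdW = -realDiagonal L dW' hdW') (χ : HeckeCharacter L) {sD : HA L e dV hdV dW hdW →* MpD L e dV hdV dW hdW}
    (hsD : IsDoubledWeilRep L e dV hdV hdV0 dW hdW hdW0 χ sD) :
    IsDoubledWeilRep L e dV hdV hdV0 dW' hdW' hdW0' (galConj (IsCMField.complexConj L) χ)
      (((adelicMpContRelabel (Fp L) (Fin (n + n)) (-1) (gramDA_mul_negOne hneg)).toMonoidHom.comp sD).comp (conjH hneg)) :=
  isDoubledWeilRep_relabel_comp_conj hdV0 hdW0 (gramDA_mul_negOne hneg) (coe_coe_conjH hneg) (continuous_conjH hneg)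
    (symplecticGroupCongr_toSpD_conjH hneg) χ hsD hdW0'

end TransportConjH

end Literature.NumberTheory.GelbartRogawski1991.GRConstruction

end
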